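import Summits.ResolutionOfSingularities.ResolutionOfSingularities.Theorems.WeightedInvariantKeyRungThreeOfDropPointIso
import Summits.ResolutionOfSingularities.ResolutionOfSingularities.Theorems.WeightedInvariantIota3IsoSuccDim
import Summits.ResolutionOfSingularities.ResolutionOfSingularities.Theorems.WeightedInvariantHypersurfaceLocalGameEFTSuccessorRegular
import Summits.ResolutionOfSingularities.ResolutionOfSingularities.Theorems.WeightedInvariantOrderNonIncrease
import HarnessLib

/-!
# (D-b³-point-STAT), ISOLATED regime IS the pointwise `σ`-comparison — the gap list `keyRungGrHomLE_three_of_tieDescent_pointSigma`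
# (door `HypersurfaceCentreConstruction`, stmt-ResolutionOfSingularities-19897, stub `stub_keyRungGrHomLE_three`)

Topic: `Summits/ResolutionOfSingularities/ResolutionOfSingularities/Theorems`.  DEF-FREE.  Helper `--supports stmt-ResolutionOfSingularities-19897`.

Closes the bookkeeping of this hand's (iso-succ) PART C chain for the ISOLATED point regime of (D-b³-point-STAT) (…KeyRungThreeOfDropPointStat,
…KeyRungThreeOfDropPointIso):  at an ISOLATED start `(S, f)` and an order-stationary `t`-homogeneous successor `𝔫` (any presentation `(u, w)` of
`J₃ᵗ`), the successor position `(B_𝔫, g/1)` is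

* REGULAR local (tree: `isRegularLocalRing_localization_cobordantAlgebra'`, …HypersurfaceLocalGameEFTSuccessorRegular),
* of Krull dimension `≤ 3` (…IsoSuccDim `ringKrullDim_localization_le_of_isTHomogeneous`, carrier-transported),
* of order EXACTLY `ν` (`g/1 ∉ 𝔪_𝔫^{ν+1}`: «ν does not rise», …OrderNonIncrease `iotaOrd_transform_le_of_isUnit_coeff` on the unit coefficient of standard
  degree `ν` of the σ-face expansion, (BR3) `exists_mem_degree_eq_and_not_mem`),
* ISOLATED (`pointStat_isolated`),

so both stratifiers read `ι₀ = (ν ; 0 ; 0)` and both `σ`-cylinders are pointwise (…CurveFracTieZeroSigmaReduction), and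
**`ι₃ᵗ(B_𝔫, g/1) < ι₃ᵗ(S, f) ↔ σ(B_𝔫, g/1) < σ(S, f)`** (`Iota3.pointStat_isolated_iff_iotaSigma_lt`).

GAP LISTS **`keyRungGrHomLE_three_of_tieDescent_pointSigma`** / **`_c11_pointSigma`**: `KeyRungGrHomLE 3 p` ⟸ hD (resp. (c11)≤3) +
**(SIGMA-POINT-ISO)** «at an ISOLATED start, for every presentation of `J₃ᵗ`, at every order-stationary `t`-homogeneous successor `𝔫` over the closed
point — GIVEN regular, of dimension `≤ 3`, of order exactly `ν`, isolated, with the order drop strictly below —: `σ(B_𝔫, g/1) < σ(S, f)`» +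
(D-b³-point-STAT-REST) (TIE / CROSSING point starts, verbatim).  (SIGMA-POINT-ISO) is the research core: the drop of the flag-maximised
`(a₂/a₁, a₃/a₁)` under the weighted blow-up at the orbit-points of multiplicity `ν` of `in_w f`, in characteristic `p`.

[OURS · L1 W4.3 · audit glue; AI work, weaker than expert review; nothing here is a statement of the manuscript under review (Hironaka 2017,
[claim: Hironaka2017, status: under-review]).]

## References

* D. Abramovich, M. Temkin, J. Włodarczyk, *Functorial embedded resolution via weighted blowings up*, Algebra & Number Theory 18 (2024), §5. [AbramovichTemkinWlodarczyk2024]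
* J. Włodarczyk, *Functorial resolution by torus actions*, arXiv:2203.03090, §3.3, Lemma 4.1.7. [Wlodarczyk2022]
-/

noncomputable section

set_option linter.dupNamespace false -- mandated namespace of this single-conjunct summit

open IsLocalRing Literature.AlgebraicGeometry.Resolution
open Summit.ResolutionOfSingularities.ResolutionOfSingularities.Theorems
open Summit.ResolutionOfSingularities.ResolutionOfSingularities.Theorems.ContactCylinder

namespace Summit.ResolutionOfSingularities.ResolutionOfSingularities.Cruxes.HypersurfaceCentreConstruction.LocalEngine

namespace Iota3

/-! ## Two isolated positions of the same order compare by `σ` -/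

/-- **Two ISOLATED positions of the same order `ν ≥ 1` (regular local rings of Krull dimension `≤ 3`) compare in `ι₃ᵗ` exactly as in `σ`.**
[OURS · L1 W4.3] -/
theorem iotaFlatT_lt_iff_iotaSigma_lt_of_isIsolated {R S : Type} [CommRing R] [IsRegularLocalRing R] [CommRing S] [IsRegularLocalRing S]
    (hdimR : ringKrullDim R ≤ 3) (hdimS : ringKrullDim S ≤ 3) {g : R} {f : S} {ν : ℕ} (hν : 1 ≤ ν)
    (hgν : g ∈ maximalIdeal R ^ ν) (hgν1 : g ∉ maximalIdeal R ^ (ν + 1)) (hisoR : IsIsolatedPosition R g)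
    (hfν : f ∈ maximalIdeal S ^ ν) (hfν1 : f ∉ maximalIdeal S ^ (ν + 1)) (hisoS : IsIsolatedPosition S f) :
    iotaFlatT R g < iotaFlatT S f ↔ iotaSigma R g < iotaSigma S f := by
  have hg : g ∈ maximalIdeal R := by have h := Ideal.pow_le_pow_right hν hgν; rwa [pow_one] at h
  have hf : f ∈ maximalIdeal S := by have h := Ideal.pow_le_pow_right hν hfν; rwa [pow_one] at h
  rw [iotaFlatT_lt_iff, iotaOrdEpsTau_eq_of_isIsolatedPosition hdimR hν hgν hgν1 hisoR,
    iotaOrdEpsTau_eq_of_isIsolatedPosition hdimS hν hfν hfν1 hisoS, iotaCylinder_eq_iotaSigma_of_isIsolated hdimR hg hisoR,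
    iotaCylinder_eq_iotaSigma_of_isIsolated hdimS hf hisoS]
  exact ⟨fun h => (h.resolve_left (lt_irrefl _)).2, fun h => Or.inr ⟨rfl, h⟩⟩

/-! ## Carrier-transported successor bookkeeping -/

/-- «ν does not rise» (…OrderNonIncrease) with the filtration carrier-transported. [OURS · seam] -/
theorem iotaOrd_transform_le_of_isUnit_coeff_of_eq {S : Type} [CommRing S] [IsRegularLocalRing S] {d : ℕ} (u : Fin d → S) (w : Fin d → ℕ)
    (hu : Ideal.span (Set.range u) = maximalIdeal S) (hd : (maximalIdeal S).spanFinrank = d) (hw : ∀ i, 0 < w i)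
    (Δ : Finset (Fin d → ℕ)) (a : (Fin d → ℕ) → S) (ℓ : ℕ) {N : ℕ} (hN : 0 < N) {r : S} (hr : r ∈ (maximalIdeal S) ^ N)
    (hm : ∀ β ∈ Δ, ℓ ≤ ∑ i, w i * β i) (hℓN : ℓ < N) {f : S} (hf : f = ∑ β ∈ Δ, a β * ∏ i, u i ^ β i + r)
    {α : Fin d → ℕ} (hα : α ∈ Δ) (hwα : ∑ i, w i * α i = ℓ) (hunit : IsUnit (a α))
    {I : ℕ → Ideal S} (hI : I = weightedMonomialIdeal u w)
    (𝔫 : Ideal (extReesAlgebra I)) [𝔫.IsPrime] (hT : extReesAlgebra.tInv I ∈ 𝔫)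
    {a' : ℕ} {g : extReesAlgebra I} (hfg : algebraMap S (extReesAlgebra I) f = extReesAlgebra.tInv I ^ a' * g)
    (hndvd : ¬ extReesAlgebra.tInv I ∣ g) :
    iotaOrd (Localization.AtPrime 𝔫) (algebraMap _ (Localization.AtPrime 𝔫) g) ≤ ((∑ i, α i : ℕ) : Ordinal) := by
  subst hI
  exact OrderNonIncrease.iotaOrd_transform_le_of_isUnit_coeff u w hu hd hw Δ a ℓ hN hr hm hℓN hf hα hwα hunit 𝔫 hT hfg hndvd

/-- The dimension bound of …IsoSuccDim with the filtration carrier-transported. [OURS · seam] -/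
theorem ringKrullDim_localization_le_of_eq {S : Type} [CommRing S] [IsRegularLocalRing S] {d : ℕ} (u : Fin d → S) (w : Fin d → ℕ)
    (hu : Ideal.span (Set.range u) = maximalIdeal S) (hd : (maximalIdeal S).spanFinrank = d) (hw : ∀ i, 0 < w i)
    {I : ℕ → Ideal S} (hI : I = weightedMonomialIdeal u w)
    (𝔫 : Ideal (extReesAlgebra I)) [𝔫.IsPrime] (hT : extReesAlgebra.tInv I ∈ 𝔫)
    (hhom : Ideal.span {b | b ∈ 𝔫 ∧ SetLike.IsHomogeneousElem (KWildHom.tPiece (extReesAlgebra I)) b} = 𝔫)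
    (hV : ¬ extReesAlgebra.vertexIdeal I ≤ 𝔫) : ringKrullDim (Localization.AtPrime 𝔫) ≤ d := by
  subst hI
  exact LocalGameEFTPointMove.ringKrullDim_localization_le_of_isTHomogeneous u w hu hd hw 𝔫 hT hhom hV

/-! ## The successor of an isolated start: regular, of dimension `≤ 3`, of order exactly `ν`, isolated -/

/-- **(D-b³-point-STAT), ISOLATED regime — successor bookkeeping and the `σ`-equivalence.**  In the binders of (D-b³-point-STAT) with
`IsIsolatedPosition S f`, at an order-stationary `t`-homogeneous successor `𝔫`: `B_𝔫` is regular local of Krull dimension `≤ 3`, `g/1 ∉ 𝔪_𝔫^{ν+1}`,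
`(B_𝔫, g/1)` is isolated, the order drops strictly below `𝔫`, and `ι₃ᵗ(B_𝔫, g/1) < ι₃ᵗ(S, f) ↔ σ(B_𝔫, g/1) < σ(S, f)`. [OURS · L1 W4.3] -/
theorem pointStat_isolated_iff_iotaSigma_lt (p : ℕ) (k₀ : Type) [Field k₀] [CharP k₀ p] [PerfectField k₀]
    (S : Type) [CommRing S] [Algebra k₀ S] [Algebra.EssFiniteType k₀ S] [IsRegularLocalRing S]
    (f : S) (hd : ringKrullDim S = 3) (hf0 : f ≠ 0) (hf2 : f ∈ (maximalIdeal S) ^ 2)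
    (P : Ideal S) [P.IsPrime] (hE : topStratum iotaOrdEpsTau S f = {𝔮 | P ≤ 𝔮.asIdeal}) (hPm : P = maximalIdeal S)
    (hiso : IsIsolatedPosition S f)
    (n : ℕ) (u : Fin n → S) (w : Fin n → ℕ) (h1 : Ideal.span (Set.range u) = maximalIdeal S) (h2 : (maximalIdeal S).spanFinrank = n)
    (h5 : ∀ m : ℕ, weightedMonomialIdeal u w m = jFlatT S f m)
    (𝔫 : Ideal (cobordantAlgebra' u w)) [𝔫.IsPrime] (hhom : IsTHomogeneous u w 𝔫) (hT : cobordantT' u w ∈ 𝔫)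
    (hV : ¬ extReesAlgebra.vertexIdeal (weightedMonomialIdeal u w) ≤ 𝔫)
    (a : ℕ) (g : cobordantAlgebra' u w) (hfg : algebraMap S (cobordantAlgebra' u w) f = cobordantT' u w ^ a * g)
    (hTg : ¬ cobordantT' u w ∣ g)
    (ν : ℕ) (hfν : f ∈ maximalIdeal S ^ ν) (hfν1 : f ∉ maximalIdeal S ^ (ν + 1))
    (hgν : algebraMap (cobordantAlgebra' u w) (Localization.AtPrime 𝔫) g ∈ maximalIdeal (Localization.AtPrime 𝔫) ^ ν) :
    IsRegularLocalRing (Localization.AtPrime 𝔫) ∧ ringKrullDim (Localization.AtPrime 𝔫) ≤ 3 ∧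
      algebraMap (cobordantAlgebra' u w) (Localization.AtPrime 𝔫) g ∉ maximalIdeal (Localization.AtPrime 𝔫) ^ (ν + 1) ∧
      IsIsolatedPosition (Localization.AtPrime 𝔫) (algebraMap (cobordantAlgebra' u w) (Localization.AtPrime 𝔫) g) ∧
      (∀ (𝔮 : Ideal (cobordantAlgebra' u w)) [𝔮.IsPrime], 𝔮 < 𝔫 →
        iotaOrd (Localization.AtPrime 𝔮) (algebraMap (cobordantAlgebra' u w) (Localization.AtPrime 𝔮) g) < ν) ∧
      (iotaFlatT (Localization.AtPrime 𝔫) (algebraMap (cobordantAlgebra' u w) (Localization.AtPrime 𝔫) g) < iotaFlatT S f ↔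
        iotaSigma (Localization.AtPrime 𝔫) (algebraMap (cobordantAlgebra' u w) (Localization.AtPrime 𝔫) g) < iotaSigma S f) := by
  obtain ⟨hisoB, hbelow⟩ := pointStat_isolated p k₀ S f hd hf0 hf2 P hE hPm hiso n u w h5 𝔫 hhom hT hV a g hfg hTg ν hfν hfν1 hgν
  subst hPm
  -- regularity of the successor (tree)
  have hreg : IsRegularLocalRing (Localization.AtPrime 𝔫) := isRegularLocalRing_localization_cobordantAlgebra' u w h1 h2 𝔫 hT
  -- the position data and the canonical σ-presentation
  have hν : 0 < ν := by
    by_contra hν0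
    have hν0' : ν = 0 := by omega
    subst hν0'
    exact hfν1 (by rw [zero_add, pow_one]; exact Ideal.pow_le_self two_ne_zero hf2)
  have hfu : ¬ IsUnit f := (IsLocalRing.mem_maximalIdeal _).mp (Ideal.pow_le_self two_ne_zero hf2)
  have htop : topStratumPrime iotaOrdEpsTau S f = maximalIdeal S := topStratumPrime_eq_maximalIdeal_of_topStratum_eq _ S f hE
  have hε' : iotaEps S f ≠ 1 := by rw [iotaEps_eq_zero_of_isIsolatedPosition hiso]; exact zero_ne_one
  have hdim' : ringKrullDim S = (3 : ℕ) := by rw [hd]; norm_cast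
  have hd2 : ¬ ringKrullDim S ≤ 2 := by rw [hd]; decide
  have hd3 : (maximalIdeal S).spanFinrank = 3 := spanFinrank_eq_three_of_ringKrullDim hd
  obtain ⟨g₁, g₂, q, r₁, r₂, hmax, hprim⟩ :=
    sigmaMaximiserExistsLE3_of_atLevel p (twoFlagDominanceAtLevelLE3Body_holds p) k₀ S f hdim' hf0 hf2 htop hε'
  obtain ⟨x, h𝔪, -⟩ := exists_span_triple_of_isTwoFlag S hdim' g₁ g₂ hmax.2.1
  have hcan := jSigmaCanonicalLE3_of_atLevel p (twoFlagDominanceAtLevelLE3Body_holds p) k₀ S f hdim' hf0 hf2 htop hε'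
  have hJ : ∀ m, jFlatT S f m = weightedMonomialIdeal ![x, g₂, g₁] ![q, r₂, r₁] m := fun m =>
    jFlatT_eq_weightedMonomialIdeal_of_canonicalAt hf0 hfu htop hd2 hε' hcan hmax hprim h𝔪 m
  have hI : weightedMonomialIdeal u w = weightedMonomialIdeal ![x, g₂, g₁] ![q, r₂, r₁] := funext fun m => (h5 m).trans (hJ m)
  obtain ⟨hq, hq₂, h₂₁⟩ := hmax.1
  have hw : ∀ i, 0 < (![q, r₂, r₁] : Fin 3 → ℕ) i := vec3_pos hq hq₂ h₂₁
  have hu' : Ideal.span (Set.range ![x, g₂, g₁]) = maximalIdeal S := by rw [range_vec₃]; exact h𝔪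
  have hu'' : ∀ i, (![x, g₂, g₁] : Fin 3 → S) i ∈ Ideal.span (Set.range ![x, g₂, g₁]) := fun i => Ideal.subset_span ⟨i, rfl⟩
  -- dimension of the successor
  have hdimB : ringKrullDim (Localization.AtPrime 𝔫) ≤ 3 := by
    have h := ringKrullDim_localization_le_of_eq ![x, g₂, g₁] ![q, r₂, r₁] hu' hd3 hw hI 𝔫 hT hhom hV
    exact_mod_cast h
  -- the order of the transform is exactly `ν`
  have hadic : (adicOrder f).toNat = ν := adicOrder_toNat_eq_of_mem_of_not_mem hfν hfν1
  rw [hadic] at hmax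
  have hfJ : f ∈ weightedMonomialIdeal ![x, g₂, g₁] ![q, r₂, r₁] (r₁ * ν) := hmax.mem_weightedMonomialIdeal h𝔪
  obtain ⟨Δ, c, -, hm, hrem⟩ :=
    LocalGameEFTNewton.exists_unitExpansion_of_mem_weightedMonomialIdeal ![x, g₂, g₁] hu' ![q, r₂, r₁] hfJ (r₁ * ν + 1)
  set r : S := f - ∑ α ∈ Δ, c α * ∏ i, (![x, g₂, g₁] : Fin 3 → S) i ^ α i with hrdef
  have hf : f = ∑ α ∈ Δ, c α * ∏ i, (![x, g₂, g₁] : Fin 3 → S) i ^ α i + r := by rw [hrdef]; ring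
  have hN : 0 < r₁ * ν + 1 := Nat.succ_pos _
  have hmN : r₁ * ν < r₁ * ν + 1 := Nat.lt_succ_self _
  have hNν : ν + 1 ≤ r₁ * ν + 1 := by nlinarith
  have hr' : r ∈ Ideal.span (Set.range ![x, g₂, g₁]) ^ (r₁ * ν + 1) := by rw [hu']; exact hrem
  have hford : f ∉ Ideal.span (Set.range ![x, g₂, g₁]) ^ (ν + 1) := by rw [hu']; exact hfν1
  have hm2 : ∀ β ∈ Δ, (![q, r₂, r₁] : Fin 3 → ℕ) 2 * ν ≤ ∑ i, (![q, r₂, r₁] : Fin 3 → ℕ) i * β i :=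
    fun β hβ => by
      change r₁ * ν ≤ _
      exact hm β hβ
  obtain ⟨α, hαΔ, hαdeg, hαunit⟩ := exists_mem_degree_eq_and_not_mem (ν := ν) (N := r₁ * ν + 1)
    (Ideal.span (Set.range ![x, g₂, g₁])) ![x, g₂, g₁] hu'' ![q, r₂, r₁] 2 (vec3_le_two hq₂ h₂₁) (hw 2) hNν Δ c hm2 hr' hf hford
  have hwα : ∑ i, (![q, r₂, r₁] : Fin 3 → ℕ) i * α i = r₁ * ν := by
    refine le_antisymm ?_ (hm α hαΔ)
    calc ∑ i, (![q, r₂, r₁] : Fin 3 → ℕ) i * α i ≤ ∑ i, r₁ * α i :=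
          Finset.sum_le_sum fun i _ => Nat.mul_le_mul_right _ (vec3_le_two hq₂ h₂₁ i)
      _ = r₁ * ν := by rw [← Finset.mul_sum, hαdeg]
  have hunit : IsUnit (c α) := by
    rw [hu'] at hαunit
    simpa [IsLocalRing.mem_maximalIdeal, mem_nonunits_iff] using hαunit
  have hordle := iotaOrd_transform_le_of_isUnit_coeff_of_eq ![x, g₂, g₁] ![q, r₂, r₁] hu' hd3 hw Δ c (r₁ * ν) hN hrem hm hmN hf hαΔ
    hwα hunit hI 𝔫 hT hfg hTg
  rw [hαdeg] at hordle
  have hlt : iotaOrd (Localization.AtPrime 𝔫) (algebraMap (cobordantAlgebra' u w) (Localization.AtPrime 𝔫) g) <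
      ((ν + 1 : ℕ) : Ordinal.{0}) :=
    lt_of_le_of_lt hordle (Nat.cast_lt.mpr (Nat.lt_succ_self ν))
  have hgν1 : algebraMap (cobordantAlgebra' u w) (Localization.AtPrime 𝔫) g ∉ maximalIdeal (Localization.AtPrime 𝔫) ^ (ν + 1) :=
    fun h => absurd ((natCast_le_iotaOrd_iff (Localization.AtPrime 𝔫)
      (algebraMap (cobordantAlgebra' u w) (Localization.AtPrime 𝔫) g) (ν + 1)).mpr h) (not_le.mpr hlt)
  refine ⟨hreg, hdimB, hgν1, hisoB, hbelow, ?_⟩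
  haveI := hreg
  exact iotaFlatT_lt_iff_iotaSigma_lt_of_isIsolated hdimB (by rw [hd]) hν hgν hgν1 hisoB hfν hfν1 hiso

/-- **(D-b³-point-STAT-ISO) ⟸ (SIGMA-POINT-ISO)**: the isolated regime of (D-b³-point-STAT) follows from the pointwise `σ`-comparison at the
isolated order-stationary successors (with regularity, dimension `≤ 3`, exact order, isolation and the order drop below SUPPLIED). [OURS · L1 W4.3] -/
theorem pointStatIso_of_sigma (p : ℕ)
    (hSIGMA : ∀ (k₀ : Type) [Field k₀] [CharP k₀ p] [PerfectField k₀]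
      (S : Type) [CommRing S] [Algebra k₀ S] [Algebra.EssFiniteType k₀ S] [IsRegularLocalRing S]
      (f : S), ringKrullDim S = 3 → f ≠ 0 → f ∈ (maximalIdeal S) ^ 2 →
      ∀ (P : Ideal S) [P.IsPrime], IsRegularLocalRing (S ⧸ P) → f ∈ P →
        topStratum iotaOrdEpsTau S f = {𝔮 | P ≤ 𝔮.asIdeal} → ¬ ringKrullDim (Localization.AtPrime P) ≤ 1 →
        P = maximalIdeal S → IsIsolatedPosition S f →
        ∀ (n : ℕ) (u : Fin n → S) (w : Fin n → ℕ),
          Ideal.span (Set.range u) = maximalIdeal S → (maximalIdeal S).spanFinrank = n → (∃ i, 0 < w i) →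
          Ideal.span {x | ∃ i, 0 < w i ∧ x = u i} = P →
          (∀ m : ℕ, weightedMonomialIdeal u w m = jFlatT S f m) →
          ∀ (𝔫 : Ideal (cobordantAlgebra' u w)) [𝔫.IsPrime], IsTHomogeneous u w 𝔫 → cobordantT' u w ∈ 𝔫 →
            (maximalIdeal S).map (algebraMap S (cobordantAlgebra' u w)) ≤ 𝔫 →
            ¬ extReesAlgebra.vertexIdeal (weightedMonomialIdeal u w) ≤ 𝔫 →
            ∀ (a : ℕ) (g : cobordantAlgebra' u w), algebraMap S (cobordantAlgebra' u w) f = cobordantT' u w ^ a * g →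
              ¬ cobordantT' u w ∣ g →
              algebraMap (cobordantAlgebra' u w) (Localization.AtPrime 𝔫) g ∈ maximalIdeal (Localization.AtPrime 𝔫) ^ 2 →
              ∀ ν : ℕ, f ∈ maximalIdeal S ^ ν → f ∉ maximalIdeal S ^ (ν + 1) →
                algebraMap (cobordantAlgebra' u w) (Localization.AtPrime 𝔫) g ∈ maximalIdeal (Localization.AtPrime 𝔫) ^ ν →
                -- SUPPLIED: the successor is isolated, and the order drops strictly below it
                IsIsolatedPosition (Localization.AtPrime 𝔫) (algebraMap (cobordantAlgebra' u w) (Localization.AtPrime 𝔫) g) →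
                (∀ (𝔮 : Ideal (cobordantAlgebra' u w)) [𝔮.IsPrime], 𝔮 < 𝔫 →
                  iotaOrd (Localization.AtPrime 𝔮) (algebraMap (cobordantAlgebra' u w) (Localization.AtPrime 𝔮) g) < ν) →
                -- SUPPLIED (this file): regular, of dimension ≤ 3, of order exactly ν
                IsRegularLocalRing (Localization.AtPrime 𝔫) → ringKrullDim (Localization.AtPrime 𝔫) ≤ 3 →
                algebraMap (cobordantAlgebra' u w) (Localization.AtPrime 𝔫) g ∉ maximalIdeal (Localization.AtPrime 𝔫) ^ (ν + 1) →
              iotaSigma (Localization.AtPrime 𝔫) (algebraMap (cobordantAlgebra' u w) (Localization.AtPrime 𝔫) g) < iotaSigma S f)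
 :
    ∀ (k₀ : Type) [Field k₀] [CharP k₀ p] [PerfectField k₀]
      (S : Type) [CommRing S] [Algebra k₀ S] [Algebra.EssFiniteType k₀ S] [IsRegularLocalRing S]
      (f : S), ringKrullDim S = 3 → f ≠ 0 → f ∈ (maximalIdeal S) ^ 2 →
      ∀ (P : Ideal S) [P.IsPrime], IsRegularLocalRing (S ⧸ P) → f ∈ P →
        topStratum iotaOrdEpsTau S f = {𝔮 | P ≤ 𝔮.asIdeal} → ¬ ringKrullDim (Localization.AtPrime P) ≤ 1 →
        P = maximalIdeal S → IsIsolatedPosition S f →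
        ∀ (n : ℕ) (u : Fin n → S) (w : Fin n → ℕ),
          Ideal.span (Set.range u) = maximalIdeal S → (maximalIdeal S).spanFinrank = n → (∃ i, 0 < w i) →
          Ideal.span {x | ∃ i, 0 < w i ∧ x = u i} = P →
          (∀ m : ℕ, weightedMonomialIdeal u w m = jFlatT S f m) →
          ∀ (𝔫 : Ideal (cobordantAlgebra' u w)) [𝔫.IsPrime], IsTHomogeneous u w 𝔫 → cobordantT' u w ∈ 𝔫 →
            (maximalIdeal S).map (algebraMap S (cobordantAlgebra' u w)) ≤ 𝔫 →
            ¬ extReesAlgebra.vertexIdeal (weightedMonomialIdeal u w) ≤ 𝔫 →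
            ∀ (a : ℕ) (g : cobordantAlgebra' u w), algebraMap S (cobordantAlgebra' u w) f = cobordantT' u w ^ a * g →
              ¬ cobordantT' u w ∣ g →
              algebraMap (cobordantAlgebra' u w) (Localization.AtPrime 𝔫) g ∈ maximalIdeal (Localization.AtPrime 𝔫) ^ 2 →
              ∀ ν : ℕ, f ∈ maximalIdeal S ^ ν → f ∉ maximalIdeal S ^ (ν + 1) →
                algebraMap (cobordantAlgebra' u w) (Localization.AtPrime 𝔫) g ∈ maximalIdeal (Localization.AtPrime 𝔫) ^ ν →
                -- SUPPLIED: the successor is isolated, and the order drops strictly below it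
                IsIsolatedPosition (Localization.AtPrime 𝔫) (algebraMap (cobordantAlgebra' u w) (Localization.AtPrime 𝔫) g) →
                (∀ (𝔮 : Ideal (cobordantAlgebra' u w)) [𝔮.IsPrime], 𝔮 < 𝔫 →
                  iotaOrd (Localization.AtPrime 𝔮) (algebraMap (cobordantAlgebra' u w) (Localization.AtPrime 𝔮) g) < ν) →
              iotaFlatT (Localization.AtPrime 𝔫) (algebraMap (cobordantAlgebra' u w) (Localization.AtPrime 𝔫) g) <
                iotaFlatT S f := by
  intro k₀ _ _ _ S _ _ _ _ f hd hf0 hf2 P _ hreg hfP hE hP1 hPm hiso n u w h1 h2 h3 h4 h5 𝔫 _ hhom hT hM hV a g hfg hTg hg2 ν hfν hfν1 hgν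
    hisoB hbelow
  obtain ⟨hregB, hdimB, hgν1, -, -, hiff⟩ :=
    pointStat_isolated_iff_iotaSigma_lt p k₀ S f hd hf0 hf2 P hE hPm hiso n u w h1 h2 h5 𝔫 hhom hT hV a g hfg hTg ν hfν hfν1 hgν
  exact hiff.mpr (hSIGMA k₀ S f hd hf0 hf2 P hreg hfP hE hP1 hPm hiso n u w h1 h2 h3 h4 h5 𝔫 hhom hT hM hV a g hfg hTg hg2 ν hfν hfν1 hgν
    hisoB hbelow hregB hdimB hgν1)

/-- **GAP LIST for `stub_keyRungGrHomLE_three` — hD + (SIGMA-POINT-ISO) + (D-b³-point-STAT-REST).** [OURS · L1 W4.3 · audit glue] -/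
theorem keyRungGrHomLE_three_of_tieDescent_pointSigma (p : ℕ)
    (hD : ∀ (T T' : Type) [CommRing T] [IsRegularLocalRing T] [CommRing T'] [IsRegularLocalRing T'] [Algebra T T']
      [IsLocalHom (algebraMap T T')] [Algebra.FormallySmooth T T'] [Algebra.EssFiniteType T T'] (g : T),
      ringKrullDim T' ≤ 3 → IsTiePosition T' (algebraMap T T' g) → IsTiePosition T g)
    (hSIGMA : ∀ (k₀ : Type) [Field k₀] [CharP k₀ p] [PerfectField k₀]
      (S : Type) [CommRing S] [Algebra k₀ S] [Algebra.EssFiniteType k₀ S] [IsRegularLocalRing S]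
      (f : S), ringKrullDim S = 3 → f ≠ 0 → f ∈ (maximalIdeal S) ^ 2 →
      ∀ (P : Ideal S) [P.IsPrime], IsRegularLocalRing (S ⧸ P) → f ∈ P →
        topStratum iotaOrdEpsTau S f = {𝔮 | P ≤ 𝔮.asIdeal} → ¬ ringKrullDim (Localization.AtPrime P) ≤ 1 →
        P = maximalIdeal S → IsIsolatedPosition S f →
        ∀ (n : ℕ) (u : Fin n → S) (w : Fin n → ℕ),
          Ideal.span (Set.range u) = maximalIdeal S → (maximalIdeal S).spanFinrank = n → (∃ i, 0 < w i) →
          Ideal.span {x | ∃ i, 0 < w i ∧ x = u i} = P →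
          (∀ m : ℕ, weightedMonomialIdeal u w m = jFlatT S f m) →
          ∀ (𝔫 : Ideal (cobordantAlgebra' u w)) [𝔫.IsPrime], IsTHomogeneous u w 𝔫 → cobordantT' u w ∈ 𝔫 →
            (maximalIdeal S).map (algebraMap S (cobordantAlgebra' u w)) ≤ 𝔫 →
            ¬ extReesAlgebra.vertexIdeal (weightedMonomialIdeal u w) ≤ 𝔫 →
            ∀ (a : ℕ) (g : cobordantAlgebra' u w), algebraMap S (cobordantAlgebra' u w) f = cobordantT' u w ^ a * g →
              ¬ cobordantT' u w ∣ g →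
              algebraMap (cobordantAlgebra' u w) (Localization.AtPrime 𝔫) g ∈ maximalIdeal (Localization.AtPrime 𝔫) ^ 2 →
              ∀ ν : ℕ, f ∈ maximalIdeal S ^ ν → f ∉ maximalIdeal S ^ (ν + 1) →
                algebraMap (cobordantAlgebra' u w) (Localization.AtPrime 𝔫) g ∈ maximalIdeal (Localization.AtPrime 𝔫) ^ ν →
                -- SUPPLIED: the successor is isolated, and the order drops strictly below it
                IsIsolatedPosition (Localization.AtPrime 𝔫) (algebraMap (cobordantAlgebra' u w) (Localization.AtPrime 𝔫) g) →
                (∀ (𝔮 : Ideal (cobordantAlgebra' u w)) [𝔮.IsPrime], 𝔮 < 𝔫 →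
                  iotaOrd (Localization.AtPrime 𝔮) (algebraMap (cobordantAlgebra' u w) (Localization.AtPrime 𝔮) g) < ν) →
                -- SUPPLIED (this file): regular, of dimension ≤ 3, of order exactly ν
                IsRegularLocalRing (Localization.AtPrime 𝔫) → ringKrullDim (Localization.AtPrime 𝔫) ≤ 3 →
                algebraMap (cobordantAlgebra' u w) (Localization.AtPrime 𝔫) g ∉ maximalIdeal (Localization.AtPrime 𝔫) ^ (ν + 1) →
              iotaSigma (Localization.AtPrime 𝔫) (algebraMap (cobordantAlgebra' u w) (Localization.AtPrime 𝔫) g) < iotaSigma S f)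
    (hREST : ∀ (k₀ : Type) [Field k₀] [CharP k₀ p] [PerfectField k₀]
      (S : Type) [CommRing S] [Algebra k₀ S] [Algebra.EssFiniteType k₀ S] [IsRegularLocalRing S]
      (f : S), ringKrullDim S = 3 → f ≠ 0 → f ∈ (maximalIdeal S) ^ 2 →
      ∀ (P : Ideal S) [P.IsPrime], IsRegularLocalRing (S ⧸ P) → f ∈ P →
        topStratum iotaOrdEpsTau S f = {𝔮 | P ≤ 𝔮.asIdeal} → ¬ ringKrullDim (Localization.AtPrime P) ≤ 1 →
        P = maximalIdeal S → ¬ IsIsolatedPosition S f →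
        ∀ (n : ℕ) (u : Fin n → S) (w : Fin n → ℕ),
          Ideal.span (Set.range u) = maximalIdeal S → (maximalIdeal S).spanFinrank = n → (∃ i, 0 < w i) →
          Ideal.span {x | ∃ i, 0 < w i ∧ x = u i} = P →
          (∀ m : ℕ, weightedMonomialIdeal u w m = jFlatT S f m) →
          ∀ (𝔫 : Ideal (cobordantAlgebra' u w)) [𝔫.IsPrime], IsTHomogeneous u w 𝔫 → cobordantT' u w ∈ 𝔫 →
            (maximalIdeal S).map (algebraMap S (cobordantAlgebra' u w)) ≤ 𝔫 →
            ¬ extReesAlgebra.vertexIdeal (weightedMonomialIdeal u w) ≤ 𝔫 →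
            ∀ (a : ℕ) (g : cobordantAlgebra' u w), algebraMap S (cobordantAlgebra' u w) f = cobordantT' u w ^ a * g →
              ¬ cobordantT' u w ∣ g →
              algebraMap (cobordantAlgebra' u w) (Localization.AtPrime 𝔫) g ∈ maximalIdeal (Localization.AtPrime 𝔫) ^ 2 →
              ∀ ν : ℕ, f ∈ maximalIdeal S ^ ν → f ∉ maximalIdeal S ^ (ν + 1) →
                algebraMap (cobordantAlgebra' u w) (Localization.AtPrime 𝔫) g ∈ maximalIdeal (Localization.AtPrime 𝔫) ^ ν →
              iotaFlatT (Localization.AtPrime 𝔫) (algebraMap (cobordantAlgebra' u w) (Localization.AtPrime 𝔫) g) <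
                iotaFlatT S f) : KeyRungGrHomLE 3 p :=
  keyRungGrHomLE_three_of_tieDescent_pointStatIso p hD (pointStatIso_of_sigma p hSIGMA) hREST

/-- **GAP LIST, (c11)-form — (c11)≤3 + (SIGMA-POINT-ISO) + (D-b³-point-STAT-REST).** [OURS · L1 W4.3 · audit glue] -/
theorem keyRungGrHomLE_three_of_c11_pointSigma (p : ℕ) (hc11 : IotaJEssSmoothCompatibleLE 3 iotaFlatT jFlatT)
    (hSIGMA : ∀ (k₀ : Type) [Field k₀] [CharP k₀ p] [PerfectField k₀]
      (S : Type) [CommRing S] [Algebra k₀ S] [Algebra.EssFiniteType k₀ S] [IsRegularLocalRing S]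
      (f : S), ringKrullDim S = 3 → f ≠ 0 → f ∈ (maximalIdeal S) ^ 2 →
      ∀ (P : Ideal S) [P.IsPrime], IsRegularLocalRing (S ⧸ P) → f ∈ P →
        topStratum iotaOrdEpsTau S f = {𝔮 | P ≤ 𝔮.asIdeal} → ¬ ringKrullDim (Localization.AtPrime P) ≤ 1 →
        P = maximalIdeal S → IsIsolatedPosition S f →
        ∀ (n : ℕ) (u : Fin n → S) (w : Fin n → ℕ),
          Ideal.span (Set.range u) = maximalIdeal S → (maximalIdeal S).spanFinrank = n → (∃ i, 0 < w i) →
          Ideal.span {x | ∃ i, 0 < w i ∧ x = u i} = P →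
          (∀ m : ℕ, weightedMonomialIdeal u w m = jFlatT S f m) →
          ∀ (𝔫 : Ideal (cobordantAlgebra' u w)) [𝔫.IsPrime], IsTHomogeneous u w 𝔫 → cobordantT' u w ∈ 𝔫 →
            (maximalIdeal S).map (algebraMap S (cobordantAlgebra' u w)) ≤ 𝔫 →
            ¬ extReesAlgebra.vertexIdeal (weightedMonomialIdeal u w) ≤ 𝔫 →
            ∀ (a : ℕ) (g : cobordantAlgebra' u w), algebraMap S (cobordantAlgebra' u w) f = cobordantT' u w ^ a * g →
              ¬ cobordantT' u w ∣ g →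
              algebraMap (cobordantAlgebra' u w) (Localization.AtPrime 𝔫) g ∈ maximalIdeal (Localization.AtPrime 𝔫) ^ 2 →
              ∀ ν : ℕ, f ∈ maximalIdeal S ^ ν → f ∉ maximalIdeal S ^ (ν + 1) →
                algebraMap (cobordantAlgebra' u w) (Localization.AtPrime 𝔫) g ∈ maximalIdeal (Localization.AtPrime 𝔫) ^ ν →
                -- SUPPLIED: the successor is isolated, and the order drops strictly below it
                IsIsolatedPosition (Localization.AtPrime 𝔫) (algebraMap (cobordantAlgebra' u w) (Localization.AtPrime 𝔫) g) →
                (∀ (𝔮 : Ideal (cobordantAlgebra' u w)) [𝔮.IsPrime], 𝔮 < 𝔫 →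
                  iotaOrd (Localization.AtPrime 𝔮) (algebraMap (cobordantAlgebra' u w) (Localization.AtPrime 𝔮) g) < ν) →
                -- SUPPLIED (this file): regular, of dimension ≤ 3, of order exactly ν
                IsRegularLocalRing (Localization.AtPrime 𝔫) → ringKrullDim (Localization.AtPrime 𝔫) ≤ 3 →
                algebraMap (cobordantAlgebra' u w) (Localization.AtPrime 𝔫) g ∉ maximalIdeal (Localization.AtPrime 𝔫) ^ (ν + 1) →
              iotaSigma (Localization.AtPrime 𝔫) (algebraMap (cobordantAlgebra' u w) (Localization.AtPrime 𝔫) g) < iotaSigma S f)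
    (hREST : ∀ (k₀ : Type) [Field k₀] [CharP k₀ p] [PerfectField k₀]
      (S : Type) [CommRing S] [Algebra k₀ S] [Algebra.EssFiniteType k₀ S] [IsRegularLocalRing S]
      (f : S), ringKrullDim S = 3 → f ≠ 0 → f ∈ (maximalIdeal S) ^ 2 →
      ∀ (P : Ideal S) [P.IsPrime], IsRegularLocalRing (S ⧸ P) → f ∈ P →
        topStratum iotaOrdEpsTau S f = {𝔮 | P ≤ 𝔮.asIdeal} → ¬ ringKrullDim (Localization.AtPrime P) ≤ 1 →
        P = maximalIdeal S → ¬ IsIsolatedPosition S f →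
        ∀ (n : ℕ) (u : Fin n → S) (w : Fin n → ℕ),
          Ideal.span (Set.range u) = maximalIdeal S → (maximalIdeal S).spanFinrank = n → (∃ i, 0 < w i) →
          Ideal.span {x | ∃ i, 0 < w i ∧ x = u i} = P →
          (∀ m : ℕ, weightedMonomialIdeal u w m = jFlatT S f m) →
          ∀ (𝔫 : Ideal (cobordantAlgebra' u w)) [𝔫.IsPrime], IsTHomogeneous u w 𝔫 → cobordantT' u w ∈ 𝔫 →
            (maximalIdeal S).map (algebraMap S (cobordantAlgebra' u w)) ≤ 𝔫 →
            ¬ extReesAlgebra.vertexIdeal (weightedMonomialIdeal u w) ≤ 𝔫 →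
            ∀ (a : ℕ) (g : cobordantAlgebra' u w), algebraMap S (cobordantAlgebra' u w) f = cobordantT' u w ^ a * g →
              ¬ cobordantT' u w ∣ g →
              algebraMap (cobordantAlgebra' u w) (Localization.AtPrime 𝔫) g ∈ maximalIdeal (Localization.AtPrime 𝔫) ^ 2 →
              ∀ ν : ℕ, f ∈ maximalIdeal S ^ ν → f ∉ maximalIdeal S ^ (ν + 1) →
                algebraMap (cobordantAlgebra' u w) (Localization.AtPrime 𝔫) g ∈ maximalIdeal (Localization.AtPrime 𝔫) ^ ν →
              iotaFlatT (Localization.AtPrime 𝔫) (algebraMap (cobordantAlgebra' u w) (Localization.AtPrime 𝔫) g) <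
                iotaFlatT S f) : KeyRungGrHomLE 3 p :=
  keyRungGrHomLE_three_of_c11_pointStatIso p hc11 (pointStatIso_of_sigma p hSIGMA) hREST

end Iota3

end Summit.ResolutionOfSingularities.ResolutionOfSingularities.Cruxes.HypersurfaceCentreConstruction.LocalEngine

end
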